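import Mathlib.Combinatorics.SimpleGraph.Finite
import Mathlib.Combinatorics.SimpleGraph.Connectivity.Connected
import Mathlib.Data.Sym.Sym2.Order
import Mathlib.Data.List.Sublists
import Mathlib.Data.Fintype.Pi
import Literature.Computability.Complexity.CNF
import Literature.Computability.MetaComplexity.Resolution
import Literature.Computability.MetaComplexity.ResLin
import HarnessLib

/-!
# Complexity meta: Tseitin formulas lifted with the 3-bit majority gadget; critical assignments

Companion to the Tseitin section of `Literature.Computability.MetaComplexity.Resolution`
(`tseitinEdgeVar`, `tseitinNeighbors`, `tseitinCNF`) and to `…MetaComplexity.ResLin` (linear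
clauses, the proof system Res(⊕)). It fixes, at statement level only,

* the LIFTED Tseitin contradiction `τ(G, c) ∘ MAJ₃` of Bhattacharya–Byramji–Chattopadhyay–Impagliazzo
  (STOC 2026, Thm 1.2: the Tseitin contradiction on a graph `G` on `Fin N` with charge `c`, every edge
  variable `x_e` replaced by the majority of three fresh copies `x_{e,0}, x_{e,1}, x_{e,2}`; a
  `3Δ`-CNF with `≤ N · 2^{3Δ}` clauses for maximum degree `Δ`): `liftVar`, `liftVars`, `gadgetMaj3`,
  `edgeVal`, `vertexOK`, `tseitinMajVertexClauses`, `tseitinMaj`;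
* total assignments of the `3 N²` variable slots as `Fin (3 * N ^ 2) → Bool`, read as `ℕ → Bool` by `pad`;
* CRITICAL ASSIGNMENTS: `critAt G c u` = the assignments satisfying the parity constraint of every vertex
  except exactly `u` (the Tseitin analogue of Haken's `i`-critical assignments, Jukna 2012 §18.4, §18.7),
  and the CRITICAL SUPPORT `critSupport G c C` of a linear clause `C` = the vertices `u` such that some
  `u`-critical assignment falsifies `C` (the analogue of `Pigeon(C)`, Jukna 2012 §18.4);
* the edge cut `edgeCut G U` = the edges with exactly one endpoint in `U` (`e(S, V ∖ S)` of the
  Ben-Sasson–Wigderson edge-expansion width bound, Jukna 2012 Thm 18.17).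

No facts are asserted here; the objects are consumed by summit-side statements about Res(⊕)
refutations of `τ(G, c) ∘ MAJ₃` on expanders.

## References

* S. K. Bhattacharya, F. Byramji, A. Chattopadhyay, R. Impagliazzo, *Lower bounds for
  near-quadratic-depth resolution over parities*, STOC 2026, Thm 1.1–1.2 and §5 (Tseitin
  contradiction over an expander lifted with a 1-stifling gadget such as `MAJ₃`).
* Y. Alekseev, D. Itsykson, *Lifting to bounded-depth and regular resolutions over parities via
  games*, STOC 2025 (lifted Tseitin formulas in Res(⊕)).
* S. Jukna, *Boolean Function Complexity*, Springer 2012, §18.4 (critical assignments, `Pigeon(C)`),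
  §18.7 (Tseitin formulas; Thm 18.17, edge expansion `ex(G)` and `e(S, V ∖ S)`).
* A. Urquhart, *Hard examples for resolution*, J. ACM 34 (1987), §4.
-/

namespace Literature.Computability.MetaComplexity

open _root_.Computability Complexity Finset

section TseitinLift

variable {N : ℕ}

/-! ### The lifted formula `τ(G, c) ∘ MAJ₃` -/

/-- The `i`-th copy (`i < 3`) of the variable of edge `e`: slot `3 · tseitinEdgeVar e + i`
(all slots are `< 3 N²`). [Bhattacharya–Byramji–Chattopadhyay–Impagliazzo 2026, §1 (the lifted
formula `φ ∘ g`: `b` fresh copies per variable)] [cite: BhattacharyaEtAl2026, Thm 1.1] -/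
def liftVar (e : Sym2 (Fin N)) (i : ℕ) : ℕ :=
  3 * tseitinEdgeVar e + i

/-- The list of the `3 · deg(u)` lifted variables of the star of `u` (neighbours in increasing order,
copies `0, 1, 2`). [Bhattacharya–Byramji–Chattopadhyay–Impagliazzo 2026, §1] [cite: BhattacharyaEtAl2026, Thm 1.1] -/
def liftVars (G : SimpleGraph (Fin N)) [DecidableRel G.Adj] (u : Fin N) : List ℕ :=
  (tseitinNeighbors G u).flatMap fun w => [liftVar s(u, w) 0, liftVar s(u, w) 1, liftVar s(u, w) 2]

/-- The 3-bit majority gadget `MAJ₃(a, b, c) = (a ∧ b) ∨ ((a ∨ b) ∧ c)`.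
[Bhattacharya–Byramji–Chattopadhyay–Impagliazzo 2026, Thm 1.2 (3-bit majority gadget)]
[cite: BhattacharyaEtAl2026, Thm 1.2] -/
def gadgetMaj3 (a b c : Bool) : Bool :=
  (a && b) || ((a || b) && c)

/-- The lifted value of edge `e` under `σ : ℕ → Bool`: the majority of its three copies.
[Bhattacharya–Byramji–Chattopadhyay–Impagliazzo 2026, Thm 1.2] [cite: BhattacharyaEtAl2026, Thm 1.2] -/
def edgeVal (σ : ℕ → Bool) (e : Sym2 (Fin N)) : Bool :=
  gadgetMaj3 (σ (liftVar e 0)) (σ (liftVar e 1)) (σ (liftVar e 2))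

/-- The (lifted) parity constraint of vertex `u`: the number of neighbours `w` whose edge `s(u, w)`
has lifted value `true` has parity `c u`. [Bhattacharya–Byramji–Chattopadhyay–Impagliazzo 2026, §5
(the Tseitin constraint `Σ_{e ∋ v} x_e = c(v)`), composed with `MAJ₃`] [cite: BhattacharyaEtAl2026, Thm 1.2] -/
def vertexOK (G : SimpleGraph (Fin N)) [DecidableRel G.Adj] (c : Fin N → Bool) (σ : ℕ → Bool)
    (u : Fin N) : Bool :=
  decide (((G.neighborFinset u).filter fun w => edgeVal σ s(u, w) = true).card % 2 = (c u).toNat)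

/-- The clauses of `τ(G, c) ∘ MAJ₃` at vertex `u`: for every assignment `T` (read as the set of true
variables) of the `3 · deg(u)` star variables violating the lifted parity constraint of `u`, the clause
of width `3 · deg(u)` falsified exactly by `T`. [Bhattacharya–Byramji–Chattopadhyay–Impagliazzo 2026,
Thm 1.2 and §5 (`2^{d-1}` clauses per vertex before lifting)] [cite: BhattacharyaEtAl2026, Thm 1.2] -/
def tseitinMajVertexClauses (G : SimpleGraph (Fin N)) [DecidableRel G.Adj] (c : Fin N → Bool)
    (u : Fin N) : CNF ℕ :=
  ((liftVars G u).sublists.filter fun T => vertexOK G c (fun i => decide (i ∈ T)) u = false).map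
    fun T => (liftVars G u).map fun i => (i, decide (i ∉ T))

/-- **The Tseitin contradiction lifted with 3-bit majority**, `τ(G, c) ∘ MAJ₃`: the conjunction over
all vertices of `tseitinMajVertexClauses`. For `G` of maximum degree `Δ` it is a `3Δ`-CNF with at most
`N · 2^{3Δ}` clauses on the variable slots `< 3 N²`; it is unsatisfiable when the total charge is odd.
[Bhattacharya–Byramji–Chattopadhyay–Impagliazzo 2026, Thm 1.2 ("instantiating with a 3-regular
expander and 3-bit majority we get a 6-CNF")] [cite: BhattacharyaEtAl2026, Thm 1.2] -/
def tseitinMaj (G : SimpleGraph (Fin N)) [DecidableRel G.Adj] (c : Fin N → Bool) : CNF ℕ :=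
  (List.finRange N).flatMap (tseitinMajVertexClauses G c)

/-! ### Total assignments and critical assignments -/

/-- A total assignment of the `3 N²` variable slots, read as an assignment of all of `ℕ`
(`false` beyond the slots). [folklore] -/
def pad (x : Fin (3 * N ^ 2) → Bool) : ℕ → Bool :=
  fun i => if h : i < 3 * N ^ 2 then x ⟨i, h⟩ else false

/-- **Critical assignments at `u`**: the total assignments satisfying the lifted parity constraint of
every vertex other than `u` and violating that of `u` — the Tseitin analogue of the `i`-critical
assignments of the pigeonhole principle. [Jukna 2012, §18.4 (`i`-critical assignments) and §18.7;
Urquhart 1987, §4] [cite: Jukna2012, §18.4] -/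
def critAt (G : SimpleGraph (Fin N)) [DecidableRel G.Adj] (c : Fin N → Bool) (u : Fin N) :
    Finset (Fin (3 * N ^ 2) → Bool) :=
  univ.filter fun x => ∀ w, vertexOK G c (pad x) w = true ↔ w ≠ u

/-- Membership in `critAt`. [folklore] -/
theorem mem_critAt {G : SimpleGraph (Fin N)} [DecidableRel G.Adj] {c : Fin N → Bool} {u : Fin N}
    {x : Fin (3 * N ^ 2) → Bool} :
    x ∈ critAt G c u ↔ ∀ w, vertexOK G c (pad x) w = true ↔ w ≠ u := by
  simp [critAt]

/-- **The critical support of a linear clause** `C` (with respect to `τ(G, c) ∘ MAJ₃`): the set of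
vertices `u` such that some `u`-critical assignment falsifies `C` — the analogue for vertices and
linear clauses of `Pigeon(C) = {i : some i-critical assignment falsifies C}`.
[Jukna 2012, §18.4 (`Pigeon(C)`, the weight `μ(C) = |Pigeon(C)|`)] [cite: Jukna2012, §18.4] -/
def critSupport (G : SimpleGraph (Fin N)) [DecidableRel G.Adj] (c : Fin N → Bool) (C : LinClause) :
    Finset (Fin N) :=
  univ.filter fun u => ∃ x ∈ critAt G c u, C.eval (pad x) = false

/-- Membership in `critSupport`. [folklore] -/
theorem mem_critSupport {G : SimpleGraph (Fin N)} [DecidableRel G.Adj] {c : Fin N → Bool}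
    {C : LinClause} {u : Fin N} :
    u ∈ critSupport G c C ↔ ∃ x ∈ critAt G c u, C.eval (pad x) = false := by
  simp [critSupport]

/-! ### Edge cuts -/

/-- The edge cut `e(U, V ∖ U)`: the edges of `G` with an endpoint in `U` and an endpoint outside `U`.
[Jukna 2012, Thm 18.17 (`e(S, V ∖ S)` and the edge expansion `ex(G)`); Ben-Sasson–Wigderson 2001, §6]
[cite: Jukna2012, Thm 18.17] -/
def edgeCut (G : SimpleGraph (Fin N)) [DecidableRel G.Adj] (U : Finset (Fin N)) :
    Finset (Sym2 (Fin N)) :=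
  G.edgeFinset.filter fun e => (∃ x ∈ U, x ∈ e) ∧ ∃ x ∉ U, x ∈ e

/-- Membership in `edgeCut`. [folklore] -/
theorem mem_edgeCut {G : SimpleGraph (Fin N)} [DecidableRel G.Adj] {U : Finset (Fin N)}
    {e : Sym2 (Fin N)} :
    e ∈ edgeCut G U ↔ e ∈ G.edgeSet ∧ (∃ x ∈ U, x ∈ e) ∧ ∃ x ∉ U, x ∈ e := by
  simp [edgeCut]

end TseitinLift

end Literature.Computability.MetaComplexity
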